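import Literature.MathematicalPhysics.QuantumFieldTheory.Balaban1983to89.B9Eq3130GtildePairRowsClosed
import Literature.MathematicalPhysics.QuantumFieldTheory.Balaban1983to89.B9Eq3130HessianSlotDifferenceTower
import Literature.MathematicalPhysics.QuantumFieldTheory.Balaban1983to89.B9Eq3152BareHessianGaugeModeTower

/-!
# `Balaban1983to89.B9Eq3130GtildePairRowsClosedTower` — T. Bałaban, *Propagators for lattice gauge theories in a background field*, Commun. Math. Phys. **99** (1985) 389–434
# [Balaban1985BackgroundPropagators] (3.130) p. 421 (*«G = G₀(I − Δ′_πG₀)⁻¹»*), (3.122) p. 420, (3.117)–(3.120) p. 419, (3.152) p. 426, (3.36) p. 396, Thm 3.3 p. 399,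
# p. 422 l. 1–6 (*«This inequality and Theorem 3.3 for G₀ imply a convergence of the series (3.130), for α₀ sufficiently small, in all norms … except the inequality involving
# the Laplace operator»*): **THE PAIR ROAD's END, CLOSED — THE VALUE ROW AND THE DIVERGENCE ROW OF PRINT's `G̃_k = Δ̃_{a,k}⁻¹` ON THE CELL's MODEL, ∃-FIRST, HEIGHT-FREE,
# under print's third window `‖J‖ ≤ j₁` and print's weight `c₀ = η^d`** — (K76) `exists_local_letters_pair_of_gaugeSplit` with its three displayed identities DISCHARGED BY
# NAME: `hT` = ne9-leaf-03 g80's (HSD) `B9Eq3130HessianSlotDifferenceTower.G1kPi_resolvent_stencils` (+ the unfolding of `π_k`), `h2` = (BHG)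
# `B9Eq3152BareHessianGaugeModeTower.G1k_covDerivL2K_RofUk`, `h3` = (BHG) `covDivL2K_covDerivL2K_GpOfUk_RofUk`

statement-level skeleton of published theorems with citation tags; proofs where landed; nothing here is a claim about the Yang–Mills mass gap

CITATION HEADER (lean-in-tree rule).  Audit cell `pub-balaban`, sub-cell `t4`, BINDER row NE9; filed by NE9 crux-team LEAF PROVER 05
(`b2b-balaban-t4-ne9-formalise-leaf-05`, gen 88; the pair road's END typist — OWNER t4-ne9-p1 g97 A-2 (1), journal `HOME/CLAIMS.log` l.66177).  Composed BY NAME: (K76)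
`B9Eq3130GtildePairRowsClosed.exists_local_letters_pair_of_gaugeSplit` (this lineage), (HSD) `B9Eq3130HessianSlotDifferenceTower.G1kPi_resolvent_stencils` and (BHG)
`B9Eq3152BareHessianGaugeModeTower.G1k_covDerivL2K_RofUk` ∕ `covDivL2K_covDerivL2K_GpOfUk_RofUk` (ne9-leaf-03 g80, p402616 ∕ landed 17:03Z), `B9Eq3119DeltaPiTower.piOfUk`
(unfolded), `B9Eq310HessianHermitian.adTransportW_adjoint` (`hRS` from `hUst`).  Source READ first-hand this generation (`paper:balaban1985-cmp99-background-propagators`,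
journal page = PDF page + 388): pp. 392, 396–399, 418–422, 426.  [folklore] instantiation; NOTHING of print's (3.36) ∕ (3.130)–(3.133) ∕ Thm 3.3 ∕ 3.13 is asserted,
valued or discharged.

WHAT IS PROVED (sorry-free; proof lane — no `def`).  **`exists_local_letters_G1LatticeKPi`** — `∃ (α₁, j₁, B, δ)` with `0 < α₁`, `0 < j₁`, `0 ≤ B`, `0 < δ` BEFORE the (K64)
binder block (verbatim: E162's data, the windows, `hRlev`, `hpos′`, `hpos`) + `c₀ = η^d` + the current window `‖J(b)‖ ≤ j₀ ≤ j₁` + the positivity `hposπ` of print's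
`Δ̃_{a,k}(U)` (`B9Eq3119DeltaPiTower.laplaceAkPi`, which makes `G̃_k := B11Eq103H1Complex.G1LatticeK hposπ` its two-sided inverse), such that for every coarse block `v`,
every bond field `f` supported over `Π⁻¹(v)` with `‖f‖_∞ ≤ F`, every bond `b` and site `y`: **`‖(G̃_k f)(b)‖ ≤ B·e^{−δ·d_m(Π(b₋), v)}·F`** and
**`‖(D*_U G̃_k f)(y)‖ ≤ B·e^{−δ·d_m(Πy, v)}·F`** — the (K76) constants (`δ = κ∕2`, `κ` the min of the four suppliers' rates, `B = 2·max(B_K64, B_DGK)`,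
`j₁ = min(1, 1∕(2S))`).
HONEST SCOPE.  [folklore] instantiation of (K76) at `Gt := G̃_k`; `hpos′`, `hpos`, `hposπ`, the windows, E162's data, `c₀ = η^d` and `‖J‖ ≤ j₀` stay HYPOTHESES
(`‖J‖ ≤ j₀` is print's (3.36); `hposπ` is print's Thm 3.11 ∕ (3.122) positivity, NOT proved here); constants crude; «NE9 ⇐ the named binders»; NE9 NOT PRINTED ∕ NOT PROVED;
row WALLED ON A MODEL (O-NE9-1; #5 UNRULED); spine PROVED 0∕9; rung (B)+1 on a finite T⁴ — NOT infinite volume, NOT mass gap, NOT BetaPertH, NOT Clay.  HONEST DEPENDENCY: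
continuum YM on T⁴ ⇐ BetaPertH ∧ nine spine estimates (0/9 proved); BetaPertH ⇐ (D1) ∧ (D4) ∧ CAP+tail; G-an2-4 gates asym, D1 and NE2/3/4.  NEW file importing three
modules ((K76), (HSD), (BHG)); nothing modified.  Net new unproved facts: 0.
-/

noncomputable section

set_option autoImplicit false

open scoped InnerProductSpace ComplexConjugate BigOperators

namespace Literature.MathematicalPhysics.QuantumFieldTheory.Balaban1983to89.B9Eq3130GtildePairRowsClosedTower

open B4Sect5Torus (TSite tdist tdist_nonneg tdist_symm tdist_self tdist_triangle torusSum_le)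
open B4Sect5Proof (latticeConst latticeConst_nonneg)
open B9SectCLatticeCarrier (Bond DirPair bpos btgt shift unshift)
open B9Eq311L2Pairing (WL2)
open B9Eq319QprimeTorus (fineP blockCoord)
open B7Prop1Explicit (U1 Wcx boxVec)
open B11Eq103H1Complex (SiteL2K BondL2K greenK covDerivL2K covDivL2K G1LatticeK)
open B9Eq310DeltaPrime (plaqHolU)
open B9Eq310HessianOperator (adTransportW hessOp)
open B9Eq310HessianHermitian (adTransportW_adjoint)
open B9Eq315QTorus (perCfg cornerSite)
open B9Eq315QTower (towerP UlevOf)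
open B9Eq316TowerFlatIsOneStep (towerP_eq_fineP_pow siteCast)
open B9Eq326OperatorTower (QprimeTowerW RofUk laplaceAk G1k)
open B9Eq324DeltaPrimeATower (laplacePrimeAk GpOfUk)
open B9Eq3119DeltaPiTower (piOfUk laplaceAkPi)
open B9Eq3130GtildePairRowsClosed (exists_local_letters_pair_of_gaugeSplit)
open B9Eq3130HessianSlotDifferenceTower (G1kPi_resolvent_stencils)
open B9Eq3152BareHessianGaugeModeTower (G1k_covDerivL2K_RofUk covDivL2K_covDerivL2K_GpOfUk_RofUk)

variable {d : ℕ} (hd : 1 ≤ d) (L : ℕ) [NeZero L] (hL : 1 ≤ L) (hL3 : 3 ≤ L)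
  {𝔸 : Type*} [NormedRing 𝔸] [NormedAlgebra ℂ 𝔸] [CompleteSpace 𝔸] [NormOneClass 𝔸] [StarRing 𝔸] [NormedStarGroup 𝔸] [StarModule ℂ 𝔸]
  {W : Type*} [NormedAddCommGroup W] [InnerProductSpace ℂ W] [FiniteDimensional ℂ W] (φ : W ≃ₗ[ℂ] 𝔸)
  {Mφ Mφ' : ℝ} (hMφ : 0 ≤ Mφ) (hMφ' : 0 ≤ Mφ') (hφ : ∀ w, ‖φ w‖ ≤ Mφ * ‖w‖) (hφ' : ∀ X, ‖φ.symm X‖ ≤ Mφ' * ‖X‖) (hstar : ∀ X : 𝔸, ‖star X‖ ≤ ‖X‖)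
  {a : ℝ} (ha : 0 < a) {a' : ℝ} (ha' : 0 < a') {ϱ : ℝ} (hϱ0 : 0 ≤ ϱ) (hϱ1 : ϱ < 1)
  (τ : 𝔸 →ₗ[ℂ] ℂ) {Cτ : ℝ} (hτ : ∀ X, ‖τ X‖ ≤ Cτ * ‖X‖) (hCτ : 0 ≤ Cτ) {Mτ : ℝ} (hτm : ∀ X Y : 𝔸, ‖τ (X * Y)‖ ≤ Mτ * ‖X‖ * ‖Y‖) (hMτ : 0 ≤ Mτ)
  {ρw : ℝ} (hρw : 0 ≤ ρw)
  (hτ₁ : ∀ X : 𝔸, τ (star X) = conj (τ X)) (hτ₂ : ∀ X Y : 𝔸, τ (X * Y) = τ (Y * X)) (hφτ : ∀ X Y : 𝔸, ⟪φ.symm X, φ.symm Y⟫_ℂ = τ (star X * Y))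
  (AQ : ℝ)

include hd hL hL3 hMφ hMφ' hφ hφ' hstar ha ha' hϱ0 hϱ1 hτ hCτ hτm hMτ hρw hτ₁ hτ₂ hφτ in
/-- **THE PAIR ROAD's END, CLOSED: THE VALUE ROW AND THE DIVERGENCE ROW OF `G̃_k = Δ̃_{a,k}⁻¹`, ∃-FIRST, HEIGHT-FREE** — (K76)
`exists_local_letters_pair_of_gaugeSplit` at `Gt := G̃_k` (`G1LatticeK hposπ` as a CLM), its `hT` by (HSD) `G1kPi_resolvent_stencils` (with `π_k g = g − D_U(G′_k(R_k(D*_Ug)))`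
unfolded), its `h2` by (BHG) `G1k_covDerivL2K_RofUk`, its `h3` by (BHG) `covDivL2K_covDerivL2K_GpOfUk_RofUk`; `hRS` from `hUst` by `adTransportW_adjoint`.
[cite: Balaban1985BackgroundPropagators, (3.130) p.421, (3.122) p.420, (3.117)–(3.120) p.419, (3.152) p.426, (3.36) p.396, Thm 3.3 p.399] -/
theorem exists_local_letters_G1LatticeKPi :
    ∃ α₁ j₁ B δ : ℝ, 0 < α₁ ∧ 0 < j₁ ∧ 0 ≤ B ∧ 0 < δ ∧
      ∀ (n : ℕ) (η : ℝ) (_hηL : η * (L : ℝ) ^ (n + 1) = 1) (c₀ c₁ : ℝ) [Fact (0 < c₀)] [Fact (0 < c₁)]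
        (_hw : c₀ * ((L : ℝ) ^ (n + 1)) ^ d = c₁) (_hρ : |η| ^ d / c₀ ≤ ρw) (m : Fin d → ℕ) [∀ i, NeZero (m i)] (_hm : ∀ i, 1 ≤ m i)
        (U : Bond d (towerP L m (n + 1)) → 𝔸ˣ) (αU : ℕ → ℝ) (_hα0 : ∀ j, 0 ≤ αU j) (hα1 : ∀ j, αU j ≤ 1 / 64)
        (hU1 : ∀ (j : ℕ) (x : B7Prop1Explicit.Site d) (k : Fin d), perCfg (towerP L m (j + 1)) (UlevOf L m (n + 1) U j) x k ∈ U1 𝔸)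
        (hreg : ∀ (j : ℕ) (y : TSite d (towerP L m j)) (k : Fin d) (ρ' : Fin d → Fin L),
          ‖((Wcx L (perCfg (towerP L m (j + 1)) (UlevOf L m (n + 1) U j)) (cornerSite L y) k (boxVec L ρ') : 𝔸ˣ) : 𝔸) - 1‖ ≤ αU j)
        (εU : ℕ → ℝ) (_hεU : ∀ j, 0 ≤ εU j) (_hUε : ∀ (j : ℕ) (b : Bond d (towerP L m (j + 1))), ‖(UlevOf L m (n + 1) U j b : 𝔸) - 1‖ ≤ εU j)
        (_hLb : ∀ (j : ℕ) (b : Bond d (towerP L m (j + 1))), UlevOf L m (n + 1) U j b ∈ U1 𝔸)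
        (α : ℝ) (_hα : 0 ≤ α) (_hαle : α ≤ α₁)
        (hUst : ∀ b, star (U b : 𝔸) = (((U b)⁻¹ : 𝔸ˣ) : 𝔸)) (_hUb : ∀ b, U b ∈ U1 𝔸) (_hUη : ∀ b, ‖(U b : 𝔸) - 1‖ ≤ α * η)
        (_hpl : ∀ p : B9SectCLatticeCarrier.Plaq d (towerP L m (n + 1)), ‖(plaqHolU U p : 𝔸) - 1‖ ≤ α * η ^ 2)
        (_hUgrad : ∀ (x : TSite d (towerP L m (n + 1))) (μ : Fin d), ‖(U (x, μ) : 𝔸) - U (unshift μ x, μ)‖ ≤ α * η ^ 2)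
        (_hRlev : ∀ (j : ℕ) (b : Bond d (towerP L m (j + 1))) (w : W), ‖adTransportW φ (UlevOf L m (n + 1) U j) b w‖ ≤ ‖w‖)
        (_hεg : ∀ j < n + 1, εU j ≤ α * ϱ ^ j) (_hAQ : ∑ j ∈ Finset.range (n + 1), αU j ≤ AQ)
        (hpos' : ∀ x : SiteL2K ℂ d (towerP L m (n + 1)) c₀ W, x ≠ 0 → 0 < RCLike.re ⟪x, laplacePrimeAk L m n φ η U a' (c₁ := c₁) x⟫_ℂ)
        (hpos : ∀ x : BondL2K ℂ d (towerP L m (n + 1)) c₀ W, x ≠ 0 →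
          0 < RCLike.re ⟪x, laplaceAk L m n φ η U hL αU hα1 hU1 hreg τ (c₀ := c₀) (c₁ := c₁) a x⟫_ℂ)
        (_hc₀η : c₀ = η ^ d) (j₀ : ℝ) (_hJ : ∀ μ y, ‖B9Eq39Adjoint.J (fun μ => B9Eq33CovDerivVector.shiftEquiv μ) (fun μ y => U (y, μ)) η μ y‖ ≤ j₀) (_hj : j₀ ≤ j₁)
        (hposπ : ∀ x : BondL2K ℂ d (towerP L m (n + 1)) c₀ W, x ≠ 0 →
          0 < RCLike.re ⟪x, laplaceAkPi L m n φ τ η U a' hpos' hL αU hα1 hU1 hreg (c₁ := c₁) a x⟫_ℂ)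
        (v : TSite d m) (f : BondL2K ℂ d (towerP L m (n + 1)) c₀ W) (F : ℝ)
        (_hfv : ∀ b, blockCoord (L ^ (n + 1)) m (siteCast (towerP_eq_fineP_pow L m (n + 1)) (bpos b)) ≠ v →
          WL2.equiv ℂ (fun _ : Bond d (towerP L m (n + 1)) => c₀) W f b = 0)
        (_hfF : ∀ b, ‖WL2.equiv ℂ (fun _ : Bond d (towerP L m (n + 1)) => c₀) W f b‖ ≤ F) (b : Bond d (towerP L m (n + 1))) (y : TSite d (towerP L m (n + 1))),
        ‖WL2.equiv ℂ (fun _ : Bond d (towerP L m (n + 1)) => c₀) W (G1LatticeK hposπ f) b‖ ≤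
            B * Real.exp (-(δ * tdist m (blockCoord (L ^ (n + 1)) m (siteCast (towerP_eq_fineP_pow L m (n + 1)) (bpos b))) v)) * F ∧
          ‖WL2.equiv ℂ (fun _ : TSite d (towerP L m (n + 1)) => c₀) W (covDivL2K ℂ c₀ ((η : ℂ))⁻¹ (adTransportW φ fun bb => (U bb)⁻¹) (G1LatticeK hposπ f)) y‖ ≤
            B * Real.exp (-(δ * tdist m (blockCoord (L ^ (n + 1)) m (siteCast (towerP_eq_fineP_pow L m (n + 1)) y)) v)) * F := by
  obtain ⟨α₁, j₁, B, δ, hα₁, hj₁, hB, hδ, H⟩ :=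
    exists_local_letters_pair_of_gaugeSplit hd L hL hL3 φ hMφ hMφ' hφ hφ' hstar ha ha' hϱ0 hϱ1 τ hτ hCτ hτm hMτ hρw hτ₁ hτ₂ hφτ AQ
  refine ⟨α₁, j₁, B, δ, hα₁, hj₁, hB, hδ, ?_⟩
  intro n η hηL c₀ c₁ _ _ hw hρ m _ hm U αU hα0 hα1 hU1 hreg εU hεU hUε hLb α hα hαle hUst hUb hUη hpl hUgrad hRlev hεg hAQ hpos' hpos hc₀η j₀ hJ hj
    hposπ v f F hfv hfF b y
  have hRS : ∀ (bb : Bond d (towerP L m (n + 1))) (v u : W), ⟪adTransportW φ U bb v, u⟫_ℂ = ⟪v, adTransportW φ (fun bb => (U bb)⁻¹) bb u⟫_ℂ :=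
    adTransportW_adjoint φ τ hτ₂ hUst hφτ
  -- `G̃_k` as a continuous linear map
  obtain ⟨Gt, hGt⟩ : ∃ T : BondL2K ℂ d (towerP L m (n + 1)) c₀ W →L[ℂ] BondL2K ℂ d (towerP L m (n + 1)) c₀ W,
      T = LinearMap.toContinuousLinearMap (G1LatticeK hposπ) := ⟨_, rfl⟩
  have eGt : ∀ g, Gt g = G1LatticeK hposπ g := fun g => by rw [hGt, LinearMap.coe_toContinuousLinearMap']
  -- (hT) by (HSD), `π_k` unfolded
  have hT : ∀ g, Gt g = G1k L m n φ η U hL αU hα1 hU1 hreg τ (c₀ := c₀) (c₁ := c₁) hpos g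
      + G1k L m n φ η U hL αU hα1 hU1 hreg τ (c₀ := c₀) (c₁ := c₁) hpos (hessOp φ η U τ (covDerivL2K ℂ c₀ ((η : ℂ))⁻¹ (adTransportW φ U)
          (GpOfUk L m n φ η U a' (c₁ := c₁) hpos' (RofUk L m n φ η U (c₀ := c₀)
            (covDivL2K ℂ c₀ ((η : ℂ))⁻¹ (adTransportW φ fun bb => (U bb)⁻¹) (Gt g))))))
      + G1k L m n φ η U hL αU hα1 hU1 hreg τ (c₀ := c₀) (c₁ := c₁) hpos (covDerivL2K ℂ c₀ ((η : ℂ))⁻¹ (adTransportW φ U) (RofUk L m n φ η U (c₀ := c₀)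
          (GpOfUk L m n φ η U a' (c₁ := c₁) hpos' (covDivL2K ℂ c₀ ((η : ℂ))⁻¹ (adTransportW φ fun bb => (U bb)⁻¹) (hessOp φ η U τ
            (Gt g - covDerivL2K ℂ c₀ ((η : ℂ))⁻¹ (adTransportW φ U) (GpOfUk L m n φ η U a' (c₁ := c₁) hpos'
              (RofUk L m n φ η U (c₀ := c₀) (covDivL2K ℂ c₀ ((η : ℂ))⁻¹ (adTransportW φ fun bb => (U bb)⁻¹) (Gt g)))))))))) := by
    -- `π_k w = w − D_U(G′_k(R_k(D*_U w)))`, rewritten at the ONE applied occurrence (not inside the slots of `Δ̃_{a,k}`)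
    have epi : ∀ w : BondL2K ℂ d (towerP L m (n + 1)) c₀ W, piOfUk L m n φ η U (GpOfUk L m n φ η U a' (c₁ := c₁) hpos') w =
        w - covDerivL2K ℂ c₀ ((η : ℂ))⁻¹ (adTransportW φ U) (GpOfUk L m n φ η U a' (c₁ := c₁) hpos' (RofUk L m n φ η U (c₀ := c₀)
          (covDivL2K ℂ c₀ ((η : ℂ))⁻¹ (adTransportW φ fun bb => (U bb)⁻¹) w))) := fun w => by
      simp only [piOfUk, LinearMap.sub_apply, LinearMap.id_apply, LinearMap.comp_apply]
    intro g
    have h := G1kPi_resolvent_stencils L m n φ τ η U hRS a' hpos' hL αU hα1 hU1 hreg a hpos hposπ g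
    rw [epi] at h
    rw [eGt]
    exact h
  -- (h2), (h3) by (BHG)
  have h2 : ∀ s, G1k L m n φ η U hL αU hα1 hU1 hreg τ (c₀ := c₀) (c₁ := c₁) hpos (covDerivL2K ℂ c₀ ((η : ℂ))⁻¹ (adTransportW φ U) (RofUk L m n φ η U (c₀ := c₀) s))
      = covDerivL2K ℂ c₀ ((η : ℂ))⁻¹ (adTransportW φ U) (GpOfUk L m n φ η U a' (c₁ := c₁) hpos' (RofUk L m n φ η U (c₀ := c₀) s))
        - G1k L m n φ η U hL αU hα1 hU1 hreg τ (c₀ := c₀) (c₁ := c₁) hpos (hessOp φ η U τ (covDerivL2K ℂ c₀ ((η : ℂ))⁻¹ (adTransportW φ U)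
            (GpOfUk L m n φ η U a' (c₁ := c₁) hpos' (RofUk L m n φ η U (c₀ := c₀) s)))) := fun s =>
    G1k_covDerivL2K_RofUk L m n φ η U a' hpos' hL αU hα1 hU1 hreg τ a hpos s
  have h3 : ∀ s, covDivL2K ℂ c₀ ((η : ℂ))⁻¹ (adTransportW φ fun bb => (U bb)⁻¹) (covDerivL2K ℂ c₀ ((η : ℂ))⁻¹ (adTransportW φ U)
      (GpOfUk L m n φ η U a' (c₁ := c₁) hpos' (RofUk L m n φ η U (c₀ := c₀) s))) = RofUk L m n φ η U (c₀ := c₀) s := fun s =>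
    covDivL2K_covDerivL2K_GpOfUk_RofUk L m n φ η U a' hpos' s
  have h := H n η hηL c₀ c₁ hw hρ m hm U αU hα0 hα1 hU1 hreg εU hεU hUε hLb α hα hαle hUst hUb hUη hpl hUgrad hRlev hεg hAQ hpos' hpos hc₀η j₀ hJ hj
    Gt hT h2 h3 v f F hfv hfF b y
  rw [eGt] at h
  exact h

end Literature.MathematicalPhysics.QuantumFieldTheory.Balaban1983to89.B9Eq3130GtildePairRowsClosedTower

end
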